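import Summits.BirchSwinnertonDyer.BirchSwinnertonDyer.Theorems.KolyvaginDepthDoorDepthTableRowKitOfPrint
import Summits.BirchSwinnertonDyer.BirchSwinnertonDyer.Theorems.KolyvaginDepthDoorDepthTableRows3
import Summits.BirchSwinnertonDyer.BirchSwinnertonDyer.Theorems.KolyvaginDepthDoorDepthTableRows5
import Summits.BirchSwinnertonDyer.BirchSwinnertonDyer.Theorems.KolyvaginDepthDoorDepthTableRows6
import Summits.BirchSwinnertonDyer.BirchSwinnertonDyer.Theorems.KolyvaginDepthDoorDepthTableAdditiveSurjectivityA
import Summits.BirchSwinnertonDyer.BirchSwinnertonDyer.Theorems.KolyvaginDepthDoorDepthTableAdditiveSurjectivityB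
import Summits.BirchSwinnertonDyer.BirchSwinnertonDyer.Theorems.KolyvaginDepthDoorDepthTableOddPrimeKit
import Summits.BirchSwinnertonDyer.BirchSwinnertonDyer.Theorems.Rank1ResidualIntModelReduction
import Literature.NumberTheory.EllipticCurves.ComplexMultiplicationNotSemistable
import HarnessLib

/-!
# Route `KolyvaginDepthDoor` — DEPTH-TABLE rows WITHOUT Kolyvagin's structure theorem (6/6): the
# three curves ADDITIVE at `2` — `664a1` `(5, −39, 29)`, `916c1` `(5, −111, 19)`, `944e1` `(5, −31, 239)`
# (crux `KolyvaginDepthSupply`, stmt-BirchSwinnertonDyer-21765)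

Helper file (`--supports stmt-BirchSwinnertonDyer-21765 --as helper`); it closes nothing and BSD is
not proved by it. Completes `…DepthTableRowsOfPrint1–5` (the 15 semistable curves): for the three
curves of the table with additive reduction at `2`, the `5`-adic tower surjectivity is obtained from
the tree's mod-`5` surjectivity (`C664a1/C916c1/C944e1.hasSurjectiveModNGaloisRep_5`, Serre Prop. 19,
files `…AdditiveSurjectivityA/B`) and the ODD multiplicative prime `ℓ₀ ∥ Δ` (`83`, `229`, `59`) by
`hasSurjectiveModNGaloisRep_pow_of_hasMultiplicativeReductionAtPrime`; non-CM from the same prime.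
With this file ALL 18 rows of the route's depth table exist in the hF-free currency: five named
McCallum/Gross leaves + a compatible system of Kolyvagin–Heegner data + the bit + one twist point ⟹
`t_p(E) = 0`, `rank E(ℚ) = 2`, `rank E^{(d_K)}(ℚ) = 1`. Per-curve; BSD is not proved by it.
-/

set_option linter.dupNamespace false

noncomputable section

open scoped Classical NumberField

namespace Summit.BirchSwinnertonDyer.BirchSwinnertonDyer.Theorems.KolyvaginDepthDoor

open Literature.NumberTheory.EllipticCurves Literature.NumberTheory.EllipticCurves.ModularForms
  Literature.NumberTheory.EllipticCurves.McCallum1991 WeierstrassCurve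
open Summit.BirchSwinnertonDyer.BirchSwinnertonDyer.Rank2Observatory
open Summit.BirchSwinnertonDyer.BirchSwinnertonDyer.Rank1Residual

/-! ## Row `664a1` = `[0,0,0,-7,10]` (`N = 664, |Δ| = 2⁸·83`, additive at `2`): `(p, d_K, ℓ) = (5, -39, 29)` -/

namespace C664a1

/-- **`5 ∈ B(664a1)`: `ρ̄_{E,5^m}` onto for every `m`**: `ρ̄_{E,5}` onto is the tree's
`C664a1.hasSurjectiveModNGaloisRep_5` (Serre Prop. 19, file `…AdditiveSurjectivity*`), and the
multiplicative prime `83 ∥ Δ` with `5 ∤ 1` lifts the image to `GL₂(ℤ/5^m)`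
(`hasSurjectiveModNGaloisRep_pow_of_hasMultiplicativeReductionAtPrime`).
[cite: Serre1972, §5.4 Prop. 19] [cite: SerreAbelianLadic1968, Ch. IV §3.4] -/
theorem hasSurjectiveModNGaloisRep_pow_5 (m : ℕ) :
    ((⟨0, 0, 0, -7, 10⟩ : WeierstrassCurve ℤ).map (Int.castRingHom ℚ)).HasSurjectiveModNGaloisRep
      (5 ^ m : ℕ) := by
  haveI := Fact.mk (by norm_num : Nat.Prime 5)
  haveI := isElliptic_c664a1
  haveI := isGloballyMinimal_c664a1
  exact hasSurjectiveModNGaloisRep_pow_of_hasMultiplicativeReductionAtPrime _ 5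
    hasSurjectiveModNGaloisRep_5
    (IntModel.ram_of_intModel intModel 5 83 (by norm_num) (by norm_num) (by decide +kernel)
      (by decide +kernel) (e := 1) (by decide +kernel) (by decide +kernel) (by decide +kernel)) m

/-- **`664a1` is not CM** (multiplicative reduction at `83`; a CM curve has integral `j`).
[cite: SilvermanATAEC1994, Thm. II.6.4 (PDF p. 148)] [cite: CremonaAlgorithms1997, Table 1 (664a1)] -/
theorem not_hasCM :
    haveI := isElliptic_c664a1;
    ¬ ((⟨0, 0, 0, -7, 10⟩ : WeierstrassCurve ℤ).map (Int.castRingHom ℚ)).HasCM := by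
  haveI := isElliptic_c664a1
  haveI := isGloballyMinimal_c664a1
  haveI := Fact.mk (by norm_num : Nat.Prime 83)
  intro hCM
  exact not_hasMultiplicativeReductionAtPrime_of_hasCM _ hCM 83
    (IntModel.hasMultiplicativeReductionAtPrime_of_intModel intModel 83 (by decide +kernel)
      (by decide +kernel))

/-- **DEPTH-TABLE ROW `664a1`, `(p, d_K, ℓ) = (5, -39, 29)`, WITHOUT Kolyvagin's structure theorem**:
for ANY imaginary quadratic `K` with `d_K = -39`, any frame `(Dt, β, ι)` and any COMPATIBLE system `d n`
of Kolyvagin–Heegner data, granted the five named McCallum/Gross leaves (Gross Prop. 5.4 (2);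
McCallum Lemma 4.3, Prop. 4.4, Lemma 5.3, Prop. 2.2): the bit `(d 29).kolyvaginClass _ 1 ≠ 0` and one
rational point of infinite order on `E^{(-39)}` give `corank_{ℤ_5} Ш(E)[5^∞] = 0`,
`rank_ℤ E(ℚ) = 2`, `rank_ℤ E^{(-39)}(ℚ) = 1`, `corank_{ℤ_5} Ш(E^{(-39)})[5^∞] = 0`; every
side condition (`5 ∈ B(E)`, non-CM, Heegner hypothesis, Kolyvagin prime, `2 ≤ rank`) is a kernel
theorem. Twin of `C664a1.depthRow_5_neg39_29` (file `…DepthTableRows3`, modulo `hF`).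
CONDITIONAL on the five facts, the bit, the twist point; per-curve; BSD is not proved by it.
[cite: Kolyvagin1991MathAnn, Thm. 2.3] [cite: McCallumLMS1991, §§2–5]
[cite: JetchevLauterStein2009, §3.6 (arXiv:0707.0032)] -/
theorem depthRow_5_neg39_29_of_print
    (h54 : sign_conjAct_kolyvaginClass) (h43 : lemma43_kolyvaginClass_mem_selmerLocalKer)
    (h44 : prop44_localOrder_kolyvaginClass_mul_eq) (h53 : lemma53_selmer_eigen_dependent_at)
    (h22 : prop22_reciprocity_eigen_finset)
    (K : Type) [Field K] [NumberField K] (hK : IsImaginaryQuadratic K)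
    (hD : NumberField.discr K = -39) :
    haveI := isElliptic_c664a1;
    haveI := isGloballyMinimal_c664a1;
    haveI : NeZero (((⟨0, 0, 0, -7, 10⟩ : WeierstrassCurve ℤ).map (Int.castRingHom ℚ)).conductorNorm ℤ) :=
      neZero_conductorNorm_of_isElliptic _;
    ∀ (Dt : ModularParametrizationData ((⟨0, 0, 0, -7, 10⟩ : WeierstrassCurve ℤ).map (Int.castRingHom ℚ))
        (((⟨0, 0, 0, -7, 10⟩ : WeierstrassCurve ℤ).map (Int.castRingHom ℚ)).conductorNorm ℤ)) (β : ℤ)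
      (ι : K →+* ℂ) (d : ∀ m : ℕ, KolyvaginHeegnerData Dt β ι m),
    (∀ (m l : ℕ), ∀ l' ∈ m.primeFactors, ∀ (x : ringClassField K ι m)
      (x' : ringClassField K ι (m * l)),
      (x : ℂ) = x' → (((d (m * l)).σ l' x' : ringClassField K ι (m * l)) : ℂ) = ((d m).σ l' x : ℂ)) →
    (∀ (m l : ℕ), ∀ s ∈ (d m).S, ∃ s' ∈ (d (m * l)).S, ∀ (x : ringClassField K ι m)
      (x' : ringClassField K ι (m * l)),
      (x : ℂ) = x' → ((s' x' : ringClassField K ι (m * l)) : ℂ) = (s x : ℂ)) →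
    (∀ (m l : ℕ), ∀ s' ∈ (d (m * l)).S, ∃ s ∈ (d m).S, ∀ (x : ringClassField K ι m)
      (x' : ringClassField K ι (m * l)),
      (x : ℂ) = x' → ((s' x' : ringClassField K ι (m * l)) : ℂ) = (s x : ℂ)) →
    (∀ (m l : ℕ) (x : ringClassField K ι m) (x' : ringClassField K ι (m * l)),
      (x : ℂ) = x' → (d (m * l)).emb x' = (d m).emb x) →
    (d 29).kolyvaginClass (p := 5) (by norm_num) 1 ≠ 0 →
    1 ≤ (((⟨0, 0, 0, -7, 10⟩ : WeierstrassCurve ℤ).map (Int.castRingHom ℚ)).quadraticTwist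
      ((-39 : ℤ) : ℚ)).mordellWeilRank →
    ((⟨0, 0, 0, -7, 10⟩ : WeierstrassCurve ℤ).map (Int.castRingHom ℚ)).shaCorank 5 = 0 ∧
      ((⟨0, 0, 0, -7, 10⟩ : WeierstrassCurve ℤ).map (Int.castRingHom ℚ)).mordellWeilRank = 2 ∧
      (((⟨0, 0, 0, -7, 10⟩ : WeierstrassCurve ℤ).map (Int.castRingHom ℚ)).quadraticTwist
        ((-39 : ℤ) : ℚ)).mordellWeilRank = 1 ∧
      (((⟨0, 0, 0, -7, 10⟩ : WeierstrassCurve ℤ).map (Int.castRingHom ℚ)).quadraticTwist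
        ((-39 : ℤ) : ℚ)).shaCorank 5 = 0 := by
  haveI := isElliptic_c664a1
  haveI := isGloballyMinimal_c664a1
  haveI : NeZero (((⟨0, 0, 0, -7, 10⟩ : WeierstrassCurve ℤ).map (Int.castRingHom ℚ)).conductorNorm ℤ) :=
    neZero_conductorNorm_of_isElliptic _
  intro Dt β ι d hσ hS₁ hS₂ hemb hne htw
  haveI := Fact.mk (by norm_num : Nat.Prime 5)
  exact depthRow_of_print_of_intModel_certificate intModel h54 h43 h44 h53 h22 not_hasCM
    KernelCerts001.C664a1.two_le_rank 5 (by norm_num) hasSurjectiveModNGaloisRep_pow_5 K hK hD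
    (by norm_num) (by norm_num) heegner_neg39 29 (by norm_num) (by norm_num) (by decide +kernel)
    (by norm_num) (by norm_num) (by norm_num) (by norm_num) (n := 25) card_29 (by norm_num) Dt β ι
    d hσ hS₁ hS₂ hemb hne htw

end C664a1

/-! ## Row `916c1` = `[0,0,0,-4,1]` (`N = 916, |Δ| = 2⁴·229`, additive at `2`): `(p, d_K, ℓ) = (5, -111, 19)` -/

namespace C916c1

/-- **`5 ∈ B(916c1)`: `ρ̄_{E,5^m}` onto for every `m`**: `ρ̄_{E,5}` onto is the tree's
`C916c1.hasSurjectiveModNGaloisRep_5` (Serre Prop. 19, file `…AdditiveSurjectivity*`), and the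
multiplicative prime `229 ∥ Δ` with `5 ∤ 1` lifts the image to `GL₂(ℤ/5^m)`
(`hasSurjectiveModNGaloisRep_pow_of_hasMultiplicativeReductionAtPrime`).
[cite: Serre1972, §5.4 Prop. 19] [cite: SerreAbelianLadic1968, Ch. IV §3.4] -/
theorem hasSurjectiveModNGaloisRep_pow_5 (m : ℕ) :
    ((⟨0, 0, 0, -4, 1⟩ : WeierstrassCurve ℤ).map (Int.castRingHom ℚ)).HasSurjectiveModNGaloisRep
      (5 ^ m : ℕ) := by
  haveI := Fact.mk (by norm_num : Nat.Prime 5)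
  haveI := isElliptic_c916c1
  haveI := isGloballyMinimal_c916c1
  exact hasSurjectiveModNGaloisRep_pow_of_hasMultiplicativeReductionAtPrime _ 5
    hasSurjectiveModNGaloisRep_5
    (IntModel.ram_of_intModel intModel 5 229 (by norm_num) (by norm_num) (by decide +kernel)
      (by decide +kernel) (e := 1) (by decide +kernel) (by decide +kernel) (by decide +kernel)) m

/-- **`916c1` is not CM** (multiplicative reduction at `229`; a CM curve has integral `j`).
[cite: SilvermanATAEC1994, Thm. II.6.4 (PDF p. 148)] [cite: CremonaAlgorithms1997, Table 1 (916c1)] -/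
theorem not_hasCM :
    haveI := isElliptic_c916c1;
    ¬ ((⟨0, 0, 0, -4, 1⟩ : WeierstrassCurve ℤ).map (Int.castRingHom ℚ)).HasCM := by
  haveI := isElliptic_c916c1
  haveI := isGloballyMinimal_c916c1
  haveI := Fact.mk (by norm_num : Nat.Prime 229)
  intro hCM
  exact not_hasMultiplicativeReductionAtPrime_of_hasCM _ hCM 229
    (IntModel.hasMultiplicativeReductionAtPrime_of_intModel intModel 229 (by decide +kernel)
      (by decide +kernel))

/-- **DEPTH-TABLE ROW `916c1`, `(p, d_K, ℓ) = (5, -111, 19)`, WITHOUT Kolyvagin's structure theorem**: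
for ANY imaginary quadratic `K` with `d_K = -111`, any frame `(Dt, β, ι)` and any COMPATIBLE system `d n`
of Kolyvagin–Heegner data, granted the five named McCallum/Gross leaves (Gross Prop. 5.4 (2);
McCallum Lemma 4.3, Prop. 4.4, Lemma 5.3, Prop. 2.2): the bit `(d 19).kolyvaginClass _ 1 ≠ 0` and one
rational point of infinite order on `E^{(-111)}` give `corank_{ℤ_5} Ш(E)[5^∞] = 0`,
`rank_ℤ E(ℚ) = 2`, `rank_ℤ E^{(-111)}(ℚ) = 1`, `corank_{ℤ_5} Ш(E^{(-111)})[5^∞] = 0`; every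
side condition (`5 ∈ B(E)`, non-CM, Heegner hypothesis, Kolyvagin prime, `2 ≤ rank`) is a kernel
theorem. Twin of `C916c1.depthRow_5_neg111_19` (file `…DepthTableRows5`, modulo `hF`).
CONDITIONAL on the five facts, the bit, the twist point; per-curve; BSD is not proved by it.
[cite: Kolyvagin1991MathAnn, Thm. 2.3] [cite: McCallumLMS1991, §§2–5]
[cite: JetchevLauterStein2009, §3.6 (arXiv:0707.0032)] -/
theorem depthRow_5_neg111_19_of_print
    (h54 : sign_conjAct_kolyvaginClass) (h43 : lemma43_kolyvaginClass_mem_selmerLocalKer)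
    (h44 : prop44_localOrder_kolyvaginClass_mul_eq) (h53 : lemma53_selmer_eigen_dependent_at)
    (h22 : prop22_reciprocity_eigen_finset)
    (K : Type) [Field K] [NumberField K] (hK : IsImaginaryQuadratic K)
    (hD : NumberField.discr K = -111) :
    haveI := isElliptic_c916c1;
    haveI := isGloballyMinimal_c916c1;
    haveI : NeZero (((⟨0, 0, 0, -4, 1⟩ : WeierstrassCurve ℤ).map (Int.castRingHom ℚ)).conductorNorm ℤ) :=
      neZero_conductorNorm_of_isElliptic _;
    ∀ (Dt : ModularParametrizationData ((⟨0, 0, 0, -4, 1⟩ : WeierstrassCurve ℤ).map (Int.castRingHom ℚ))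
        (((⟨0, 0, 0, -4, 1⟩ : WeierstrassCurve ℤ).map (Int.castRingHom ℚ)).conductorNorm ℤ)) (β : ℤ)
      (ι : K →+* ℂ) (d : ∀ m : ℕ, KolyvaginHeegnerData Dt β ι m),
    (∀ (m l : ℕ), ∀ l' ∈ m.primeFactors, ∀ (x : ringClassField K ι m)
      (x' : ringClassField K ι (m * l)),
      (x : ℂ) = x' → (((d (m * l)).σ l' x' : ringClassField K ι (m * l)) : ℂ) = ((d m).σ l' x : ℂ)) →
    (∀ (m l : ℕ), ∀ s ∈ (d m).S, ∃ s' ∈ (d (m * l)).S, ∀ (x : ringClassField K ι m)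
      (x' : ringClassField K ι (m * l)),
      (x : ℂ) = x' → ((s' x' : ringClassField K ι (m * l)) : ℂ) = (s x : ℂ)) →
    (∀ (m l : ℕ), ∀ s' ∈ (d (m * l)).S, ∃ s ∈ (d m).S, ∀ (x : ringClassField K ι m)
      (x' : ringClassField K ι (m * l)),
      (x : ℂ) = x' → ((s' x' : ringClassField K ι (m * l)) : ℂ) = (s x : ℂ)) →
    (∀ (m l : ℕ) (x : ringClassField K ι m) (x' : ringClassField K ι (m * l)),
      (x : ℂ) = x' → (d (m * l)).emb x' = (d m).emb x) →
    (d 19).kolyvaginClass (p := 5) (by norm_num) 1 ≠ 0 →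
    1 ≤ (((⟨0, 0, 0, -4, 1⟩ : WeierstrassCurve ℤ).map (Int.castRingHom ℚ)).quadraticTwist
      ((-111 : ℤ) : ℚ)).mordellWeilRank →
    ((⟨0, 0, 0, -4, 1⟩ : WeierstrassCurve ℤ).map (Int.castRingHom ℚ)).shaCorank 5 = 0 ∧
      ((⟨0, 0, 0, -4, 1⟩ : WeierstrassCurve ℤ).map (Int.castRingHom ℚ)).mordellWeilRank = 2 ∧
      (((⟨0, 0, 0, -4, 1⟩ : WeierstrassCurve ℤ).map (Int.castRingHom ℚ)).quadraticTwist
        ((-111 : ℤ) : ℚ)).mordellWeilRank = 1 ∧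
      (((⟨0, 0, 0, -4, 1⟩ : WeierstrassCurve ℤ).map (Int.castRingHom ℚ)).quadraticTwist
        ((-111 : ℤ) : ℚ)).shaCorank 5 = 0 := by
  haveI := isElliptic_c916c1
  haveI := isGloballyMinimal_c916c1
  haveI : NeZero (((⟨0, 0, 0, -4, 1⟩ : WeierstrassCurve ℤ).map (Int.castRingHom ℚ)).conductorNorm ℤ) :=
    neZero_conductorNorm_of_isElliptic _
  intro Dt β ι d hσ hS₁ hS₂ hemb hne htw
  haveI := Fact.mk (by norm_num : Nat.Prime 5)
  exact depthRow_of_print_of_intModel_certificate intModel h54 h43 h44 h53 h22 not_hasCM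
    KernelCerts002.C916c1.two_le_rank 5 (by norm_num) hasSurjectiveModNGaloisRep_pow_5 K hK hD
    (by norm_num) (by norm_num) heegner_neg111 19 (by norm_num) (by norm_num) (by decide +kernel)
    (by norm_num) (by norm_num) (by norm_num) (by norm_num) (n := 25) card_19 (by norm_num) Dt β ι
    d hσ hS₁ hS₂ hemb hne htw

end C916c1

/-! ## Row `944e1` = `[0,0,0,-19,34]` (`N = 944, |Δ| = 2¹⁰·59`, additive at `2`): `(p, d_K, ℓ) = (5, -31, 239)` -/

namespace C944e1

/-- **`5 ∈ B(944e1)`: `ρ̄_{E,5^m}` onto for every `m`**: `ρ̄_{E,5}` onto is the tree's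
`C944e1.hasSurjectiveModNGaloisRep_5` (Serre Prop. 19, file `…AdditiveSurjectivity*`), and the
multiplicative prime `59 ∥ Δ` with `5 ∤ 1` lifts the image to `GL₂(ℤ/5^m)`
(`hasSurjectiveModNGaloisRep_pow_of_hasMultiplicativeReductionAtPrime`).
[cite: Serre1972, §5.4 Prop. 19] [cite: SerreAbelianLadic1968, Ch. IV §3.4] -/
theorem hasSurjectiveModNGaloisRep_pow_5 (m : ℕ) :
    ((⟨0, 0, 0, -19, 34⟩ : WeierstrassCurve ℤ).map (Int.castRingHom ℚ)).HasSurjectiveModNGaloisRep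
      (5 ^ m : ℕ) := by
  haveI := Fact.mk (by norm_num : Nat.Prime 5)
  haveI := isElliptic_c944e1
  haveI := isGloballyMinimal_c944e1
  exact hasSurjectiveModNGaloisRep_pow_of_hasMultiplicativeReductionAtPrime _ 5
    hasSurjectiveModNGaloisRep_5
    (IntModel.ram_of_intModel intModel 5 59 (by norm_num) (by norm_num) (by decide +kernel)
      (by decide +kernel) (e := 1) (by decide +kernel) (by decide +kernel) (by decide +kernel)) m

/-- **`944e1` is not CM** (multiplicative reduction at `59`; a CM curve has integral `j`).
[cite: SilvermanATAEC1994, Thm. II.6.4 (PDF p. 148)] [cite: CremonaAlgorithms1997, Table 1 (944e1)] -/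
theorem not_hasCM :
    haveI := isElliptic_c944e1;
    ¬ ((⟨0, 0, 0, -19, 34⟩ : WeierstrassCurve ℤ).map (Int.castRingHom ℚ)).HasCM := by
  haveI := isElliptic_c944e1
  haveI := isGloballyMinimal_c944e1
  haveI := Fact.mk (by norm_num : Nat.Prime 59)
  intro hCM
  exact not_hasMultiplicativeReductionAtPrime_of_hasCM _ hCM 59
    (IntModel.hasMultiplicativeReductionAtPrime_of_intModel intModel 59 (by decide +kernel)
      (by decide +kernel))

/-- **DEPTH-TABLE ROW `944e1`, `(p, d_K, ℓ) = (5, -31, 239)`, WITHOUT Kolyvagin's structure theorem**: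
for ANY imaginary quadratic `K` with `d_K = -31`, any frame `(Dt, β, ι)` and any COMPATIBLE system `d n`
of Kolyvagin–Heegner data, granted the five named McCallum/Gross leaves (Gross Prop. 5.4 (2);
McCallum Lemma 4.3, Prop. 4.4, Lemma 5.3, Prop. 2.2): the bit `(d 239).kolyvaginClass _ 1 ≠ 0` and one
rational point of infinite order on `E^{(-31)}` give `corank_{ℤ_5} Ш(E)[5^∞] = 0`,
`rank_ℤ E(ℚ) = 2`, `rank_ℤ E^{(-31)}(ℚ) = 1`, `corank_{ℤ_5} Ш(E^{(-31)})[5^∞] = 0`; every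
side condition (`5 ∈ B(E)`, non-CM, Heegner hypothesis, Kolyvagin prime, `2 ≤ rank`) is a kernel
theorem. Twin of `C944e1.depthRow_5_neg31_239` (file `…DepthTableRows6`, modulo `hF`).
CONDITIONAL on the five facts, the bit, the twist point; per-curve; BSD is not proved by it.
[cite: Kolyvagin1991MathAnn, Thm. 2.3] [cite: McCallumLMS1991, §§2–5]
[cite: JetchevLauterStein2009, §3.6 (arXiv:0707.0032)] -/
theorem depthRow_5_neg31_239_of_print
    (h54 : sign_conjAct_kolyvaginClass) (h43 : lemma43_kolyvaginClass_mem_selmerLocalKer)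
    (h44 : prop44_localOrder_kolyvaginClass_mul_eq) (h53 : lemma53_selmer_eigen_dependent_at)
    (h22 : prop22_reciprocity_eigen_finset)
    (K : Type) [Field K] [NumberField K] (hK : IsImaginaryQuadratic K)
    (hD : NumberField.discr K = -31) :
    haveI := isElliptic_c944e1;
    haveI := isGloballyMinimal_c944e1;
    haveI : NeZero (((⟨0, 0, 0, -19, 34⟩ : WeierstrassCurve ℤ).map (Int.castRingHom ℚ)).conductorNorm ℤ) :=
      neZero_conductorNorm_of_isElliptic _;
    ∀ (Dt : ModularParametrizationData ((⟨0, 0, 0, -19, 34⟩ : WeierstrassCurve ℤ).map (Int.castRingHom ℚ))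
        (((⟨0, 0, 0, -19, 34⟩ : WeierstrassCurve ℤ).map (Int.castRingHom ℚ)).conductorNorm ℤ)) (β : ℤ)
      (ι : K →+* ℂ) (d : ∀ m : ℕ, KolyvaginHeegnerData Dt β ι m),
    (∀ (m l : ℕ), ∀ l' ∈ m.primeFactors, ∀ (x : ringClassField K ι m)
      (x' : ringClassField K ι (m * l)),
      (x : ℂ) = x' → (((d (m * l)).σ l' x' : ringClassField K ι (m * l)) : ℂ) = ((d m).σ l' x : ℂ)) →
    (∀ (m l : ℕ), ∀ s ∈ (d m).S, ∃ s' ∈ (d (m * l)).S, ∀ (x : ringClassField K ι m)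
      (x' : ringClassField K ι (m * l)),
      (x : ℂ) = x' → ((s' x' : ringClassField K ι (m * l)) : ℂ) = (s x : ℂ)) →
    (∀ (m l : ℕ), ∀ s' ∈ (d (m * l)).S, ∃ s ∈ (d m).S, ∀ (x : ringClassField K ι m)
      (x' : ringClassField K ι (m * l)),
      (x : ℂ) = x' → ((s' x' : ringClassField K ι (m * l)) : ℂ) = (s x : ℂ)) →
    (∀ (m l : ℕ) (x : ringClassField K ι m) (x' : ringClassField K ι (m * l)),
      (x : ℂ) = x' → (d (m * l)).emb x' = (d m).emb x) →
    (d 239).kolyvaginClass (p := 5) (by norm_num) 1 ≠ 0 →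
    1 ≤ (((⟨0, 0, 0, -19, 34⟩ : WeierstrassCurve ℤ).map (Int.castRingHom ℚ)).quadraticTwist
      ((-31 : ℤ) : ℚ)).mordellWeilRank →
    ((⟨0, 0, 0, -19, 34⟩ : WeierstrassCurve ℤ).map (Int.castRingHom ℚ)).shaCorank 5 = 0 ∧
      ((⟨0, 0, 0, -19, 34⟩ : WeierstrassCurve ℤ).map (Int.castRingHom ℚ)).mordellWeilRank = 2 ∧
      (((⟨0, 0, 0, -19, 34⟩ : WeierstrassCurve ℤ).map (Int.castRingHom ℚ)).quadraticTwist
        ((-31 : ℤ) : ℚ)).mordellWeilRank = 1 ∧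
      (((⟨0, 0, 0, -19, 34⟩ : WeierstrassCurve ℤ).map (Int.castRingHom ℚ)).quadraticTwist
        ((-31 : ℤ) : ℚ)).shaCorank 5 = 0 := by
  haveI := isElliptic_c944e1
  haveI := isGloballyMinimal_c944e1
  haveI : NeZero (((⟨0, 0, 0, -19, 34⟩ : WeierstrassCurve ℤ).map (Int.castRingHom ℚ)).conductorNorm ℤ) :=
    neZero_conductorNorm_of_isElliptic _
  intro Dt β ι d hσ hS₁ hS₂ hemb hne htw
  haveI := Fact.mk (by norm_num : Nat.Prime 5)
  exact depthRow_of_print_of_intModel_certificate intModel h54 h43 h44 h53 h22 not_hasCM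
    KernelCerts002.C944e1.two_le_rank 5 (by norm_num) hasSurjectiveModNGaloisRep_pow_5 K hK hD
    (by norm_num) (by norm_num) heegner_neg31 239 (by norm_num) (by norm_num) (by decide +kernel)
    (by norm_num) (by norm_num) (by norm_num) (by norm_num) (n := 255) card_239 (by norm_num) Dt β ι
    d hσ hS₁ hS₂ hemb hne htw

end C944e1

end Summit.BirchSwinnertonDyer.BirchSwinnertonDyer.Theorems.KolyvaginDepthDoor

end
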